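import Mathlib
import Summits.ValiantsHypothesis.ValiantsHypothesis.Theorems.TwoProducts.Negative.RankTwoEscapes
import Summits.ValiantsHypothesis.ValiantsHypothesis.Theorems.TwoProducts.Negative.CommonPadding
import HarnessLib

/-!
# NEGATIVE lane (val-neg-1 g5): FULL DEEP PADDING — `g` common gadget pairs at base-5 scales

Helper file for crux `stmt-ValiantsHypothesis-5906` (filed `--supports`; closes NO item, proves NO summit statement, does NOT prove
`TwoProducts`, `PlanarCellBound` or VP ≠ VNP; 0 `def`s).  Generalises the four-factor padding of `Negative/RankTwoPadding.lean` (same seat):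
append to BOTH sides of a normalised `t`-sparse instance `(u, v)` (`t ≥ 2`, a tail letter, `s := Σ tailSupport`) the `g + g` binomials
`z i = X^{c_i s} + X^{2 c_i s}` TWICE (`Fin.append z z`), `c_i := 2·5^i` — the gadget tuple is pinned by the hypothesis `hz`, no definition.
`fullPadding_spec`: the padded instance on `m + (g + g)` positions is normalised, `t`-sparse, has THE SAME `logSupport` and valid weights, all
new tail letters `n • s` (`n ≥ 2`), and every cell family of `(u, v)` is a cell family of it; `fullPadding_letters`: pair `i` carries the letters
`c_i s, 2 c_i s` at positions `m + i` and `m + g + i`; `fullPadding_noDatum` (`g ≥ 2`): its letter family is not of permutation type and admits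
NO rank-one datum.  The thresholds (R5)/(R1_r) are treated in `Negative/FullPaddingThresholds.lean`.  [folklore]
-/

namespace Summit.ValiantsHypothesis.Theorems.TwoProducts.Negative.FullPadding

open Finset MvPolynomial
open Summit.ValiantsHypothesis.ValiantsHypothesis.Theorems.NewtonUnitEquations.TwoProducts.FormalLogLinearisation
open Summit.ValiantsHypothesis.ValiantsHypothesis.Theorems.NewtonUnitEquations.TwoProducts.PlanarCell
open Summit.ValiantsHypothesis.ValiantsHypothesis.Theorems.NewtonUnitEquations.TwoProducts.PermutationType
  (msetT PermType RankOneCoincidences)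
open Summit.ValiantsHypothesis.Theorems.TwoProducts.Negative.RankTwoEscape (no_rankOne_datum_of_two_coincidences)
open Summit.ValiantsHypothesis.Theorems.TwoProducts.Negative.CommonPadding

variable {m g : ℕ}

/-- The scales `c_i = 2·5^i` are non-zero. [folklore] -/
theorem scale_ne_zero (i : ℕ) : 2 * 5 ^ i ≠ 0 := by positivity

/-- The scales are `≥ 2`. [folklore] -/
theorem two_le_scale (i : ℕ) : 2 ≤ 2 * 5 ^ i := by
  have := Nat.one_le_pow i 5 (by norm_num); omega

/-- The two copies of gadget `i` sit at different positions. [folklore] -/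
theorem gadget_pos_ne (i : Fin g) : (Fin.natAdd m (Fin.castAdd g i) : Fin (m + (g + g))) ≠ Fin.natAdd m (Fin.natAdd g i) := by
  intro h
  rw [Fin.ext_iff, Fin.val_natAdd, Fin.val_natAdd, Fin.val_castAdd, Fin.val_natAdd] at h
  omega

/-- **Full deep padding: specification.** [folklore] -/
theorem fullPadding_spec {t : ℕ} (ht : 2 ≤ t) (u v : Fin m → MvPolynomial (Fin 2) ℂ)
    (hu : ∀ j, coeff 0 (u j) = 0 ∧ (u j).support.card ≤ t) (hv : ∀ j, coeff 0 (v j) = 0 ∧ (v j).support.card ≤ t)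
    (hT : (tailSupport u v).Nonempty) (z : Fin g → MvPolynomial (Fin 2) ℂ)
    (hz : z = fun i : Fin g => monomial ((2 * 5 ^ (i : ℕ)) • ∑ f ∈ tailSupport u v, f) (1 : ℂ) +
      monomial ((2 * (2 * 5 ^ (i : ℕ))) • ∑ f ∈ tailSupport u v, f) 1) :
    (∀ j, coeff 0 (Fin.append u (Fin.append z z) j) = 0 ∧ (Fin.append u (Fin.append z z) j).support.card ≤ t) ∧
    (∀ j, coeff 0 (Fin.append v (Fin.append z z) j) = 0 ∧ (Fin.append v (Fin.append z z) j).support.card ≤ t) ∧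
    logSupport (Fin.append u (Fin.append z z)) (Fin.append v (Fin.append z z)) = logSupport u v ∧
    (∀ ξ, ValidWeight (Fin.append u (Fin.append z z)) (Fin.append v (Fin.append z z)) ξ ↔ ValidWeight u v ξ) ∧
    (∀ e ∈ tailSupport (Fin.append u (Fin.append z z)) (Fin.append v (Fin.append z z)),
      e ∈ tailSupport u v ∨ ∃ n, 2 ≤ n ∧ e = n • ∑ f ∈ tailSupport u v, f) ∧
    (∀ (R : Expo → Expo → Prop) (S : Finset Expo), IsCellFamily u v R S →
      ∃ R' : Expo → Expo → Prop, IsCellFamily (Fin.append u (Fin.append z z)) (Fin.append v (Fin.append z z)) R' S) := by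
  classical
  have hu0 : ∀ j, coeff 0 (u j) = 0 := fun j => (hu j).1
  have hv0 : ∀ j, coeff 0 (v j) = 0 := fun j => (hv j).1
  set s : Expo := ∑ f ∈ tailSupport u v, f with hs_def
  have hs0 : s ≠ 0 := tailSum_ne_zero hu0 hv0 hT
  have hzi : ∀ i : Fin g, z i = monomial ((2 * 5 ^ (i : ℕ)) • s) (1 : ℂ) + monomial ((2 * (2 * 5 ^ (i : ℕ))) • s) 1 :=
    fun i => by rw [hz]
  -- every gadget factor is some `z i`
  have hzz : ∀ x : Fin (g + g), ∃ i : Fin g, Fin.append z z x = z i := by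
    intro x
    induction x using Fin.addCases with
    | left i => exact ⟨i, Fin.append_left z z i⟩
    | right i => exact ⟨i, Fin.append_right z z i⟩
  have hwsupp : ∀ x : Fin (g + g), ∀ e ∈ (Fin.append z z x).support, ∃ n, 2 ≤ n ∧ e = n • s := by
    intro x e he
    obtain ⟨i, hi⟩ := hzz x
    rw [hi, hzi] at he
    rcases mem_support_gadget he with h | h
    · exact ⟨_, two_le_scale i, h⟩
    · exact ⟨_, by have := two_le_scale i; omega, h⟩
  have hwnorm : ∀ x : Fin (g + g), coeff 0 (Fin.append z z x) = 0 ∧ (Fin.append z z x).support.card ≤ t := by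
    intro x
    obtain ⟨i, hi⟩ := hzz x
    rw [hi, hzi]
    exact ⟨coeff_zero_gadget hs0 (scale_ne_zero i), (card_support_gadget s _).trans ht⟩
  have hwtail : ∀ e ∈ tailSupport (Fin.append z z) (Fin.append z z), ∃ n, 2 ≤ n ∧ e = n • s := by
    intro e he
    unfold tailSupport at he
    simp only [Finset.mem_union, Finset.mem_biUnion, Finset.mem_univ, true_and, or_self] at he
    obtain ⟨x, hx⟩ := he
    exact hwsupp x e hx
  -- the three hypotheses of `isCellFamily_append_common`
  have hneg : ∀ ξ, ValidWeight u v ξ → ValidWeight (Fin.append z z) (Fin.append z z) ξ := by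
    intro ξ hval
    have key : ∀ x, ∀ e ∈ (Fin.append z z x).support, wt ξ e < 0 := by
      intro x e he
      obtain ⟨n, hn, rfl⟩ := hwsupp x e he
      rw [wt_nsmul]
      have hsneg := wt_tailSum_neg hval hT
      have hn' : (1 : ℝ) ≤ n := by exact_mod_cast (show 1 ≤ n by omega)
      nlinarith
    exact ⟨key, key⟩
  have hdeep : ∀ ξ, ValidWeight u v ξ → ∀ e ∈ tailSupport u v, ∀ e' ∈ tailSupport (Fin.append z z) (Fin.append z z),
      wt ξ e' < wt ξ e := by
    intro ξ hval e he e' he'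
    obtain ⟨n, hn, rfl⟩ := hwtail e' he'
    exact wt_nsmul_tailSum_lt hval he hn
  have hspos : 0 < s 0 + s 1 := by
    obtain ⟨c, hc⟩ := Finsupp.ne_iff.mp hs0
    simp only [Finsupp.coe_zero, Pi.zero_apply] at hc
    rcases (Fin.exists_fin_two (p := fun c => s c ≠ 0)).mp ⟨c, hc⟩ with h | h
    · omega
    · omega
  have hQ : ∀ ξ, ValidWeight u v ξ → ∀ e ∈ tailSupport (Fin.append z z) (Fin.append z z),
      ∀ e' ∈ tailSupport (Fin.append z z) (Fin.append z z), ((e' 0 + e' 1 ≤ e 0 + e 1) ↔ wt ξ e ≤ wt ξ e') := by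
    intro ξ hval e he e' he'
    obtain ⟨n, -, rfl⟩ := hwtail e he
    obtain ⟨n', -, rfl⟩ := hwtail e' he'
    rw [wt_nsmul_tailSum_le_iff hval hT]
    simp only [Finsupp.smul_apply, smul_eq_mul, ← mul_add]
    constructor
    · exact fun h => Nat.le_of_mul_le_mul_right h hspos
    · exact fun h => Nat.mul_le_mul_right _ h
  refine ⟨norm_append u _ hu hwnorm, norm_append v _ hv hwnorm, logSupport_append_common u v _, fun ξ => ?_, fun e he => ?_,
    fun R S hS => ⟨_, isCellFamily_append_common u v _ _ hneg hdeep hQ R S hS⟩⟩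
  · rw [validWeight_append_iff]
    exact ⟨fun h => h.1, fun h => ⟨h, hneg ξ h⟩⟩
  · rw [tailSupport_append, Finset.mem_union] at he
    rcases he with he | he
    · exact Or.inl he
    · exact Or.inr (hwtail e he)

/-- **Letters of the padded family at the gadget positions**: pair `i` carries `c_i s` and `2 c_i s` at both of its positions. [folklore] -/
theorem fullPadding_letters (u v : Fin m → MvPolynomial (Fin 2) ℂ) (hs0 : ∑ f ∈ tailSupport u v, f ≠ 0)
    (z : Fin g → MvPolynomial (Fin 2) ℂ)
    (hz : z = fun i : Fin g => monomial ((2 * 5 ^ (i : ℕ)) • ∑ f ∈ tailSupport u v, f) (1 : ℂ) +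
      monomial ((2 * (2 * 5 ^ (i : ℕ))) • ∑ f ∈ tailSupport u v, f) 1) (i : Fin g) :
    ((2 * 5 ^ (i : ℕ)) • ∑ f ∈ tailSupport u v, f ∈
        (Fin.append u (Fin.append z z) (Fin.natAdd m (Fin.castAdd g i))).support ∪
          (Fin.append v (Fin.append z z) (Fin.natAdd m (Fin.castAdd g i))).support ∧
      (2 * (2 * 5 ^ (i : ℕ))) • ∑ f ∈ tailSupport u v, f ∈
        (Fin.append u (Fin.append z z) (Fin.natAdd m (Fin.castAdd g i))).support ∪
          (Fin.append v (Fin.append z z) (Fin.natAdd m (Fin.castAdd g i))).support) ∧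
    ((2 * 5 ^ (i : ℕ)) • ∑ f ∈ tailSupport u v, f ∈
        (Fin.append u (Fin.append z z) (Fin.natAdd m (Fin.natAdd g i))).support ∪
          (Fin.append v (Fin.append z z) (Fin.natAdd m (Fin.natAdd g i))).support ∧
      (2 * (2 * 5 ^ (i : ℕ))) • ∑ f ∈ tailSupport u v, f ∈
        (Fin.append u (Fin.append z z) (Fin.natAdd m (Fin.natAdd g i))).support ∪
          (Fin.append v (Fin.append z z) (Fin.natAdd m (Fin.natAdd g i))).support) := by
  have hzi : z i = monomial ((2 * 5 ^ (i : ℕ)) • ∑ f ∈ tailSupport u v, f) (1 : ℂ) +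
      monomial ((2 * (2 * 5 ^ (i : ℕ))) • ∑ f ∈ tailSupport u v, f) 1 := by rw [hz]
  simp only [Fin.append_right, Fin.append_left, Finset.union_idempotent, hzi]
  exact ⟨nsmul_mem_support_gadget hs0 (scale_ne_zero i), nsmul_mem_support_gadget hs0 (scale_ne_zero i)⟩

/-- **Full deep padding: no permutation type, NO rank-one datum** (`g ≥ 2`; planted pairs `(2c_i s ∣ 0) ~ (c_i s ∣ c_i s)` for `i = 0, 1`,
`c_0 = 2`, `c_1 = 10`, with disjoint disagreement sets `{2s, 4s}`, `{10s, 20s}`). [folklore] -/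
theorem fullPadding_noDatum (u v : Fin m → MvPolynomial (Fin 2) ℂ) (hs0 : ∑ f ∈ tailSupport u v, f ≠ 0) (hg : 2 ≤ g)
    (z : Fin g → MvPolynomial (Fin 2) ℂ)
    (hz : z = fun i : Fin g => monomial ((2 * 5 ^ (i : ℕ)) • ∑ f ∈ tailSupport u v, f) (1 : ℂ) +
      monomial ((2 * (2 * 5 ^ (i : ℕ))) • ∑ f ∈ tailSupport u v, f) 1) :
    ¬ PermType (fun j => (Fin.append u (Fin.append z z) j).support ∪ (Fin.append v (Fin.append z z) j).support) ∧
    ∀ ρp ρm : Expo →₀ ℕ,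
      ¬ RankOneCoincidences (fun j => (Fin.append u (Fin.append z z) j).support ∪ (Fin.append v (Fin.append z z) j).support)
        ρp ρm := by
  classical
  set s : Expo := ∑ f ∈ tailSupport u v, f with hs_def
  set i₀ : Fin g := ⟨0, by omega⟩ with hi₀
  set i₁ : Fin g := ⟨1, by omega⟩ with hi₁
  have hc₀ : 2 * 5 ^ (i₀ : ℕ) = 2 := by simp [hi₀]
  have hc₁ : 2 * 5 ^ (i₁ : ℕ) = 10 := by simp [hi₁]
  obtain ⟨⟨l0a, l0b⟩, ⟨m0a, -⟩⟩ := fullPadding_letters (m := m) u v hs0 z hz i₀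
  obtain ⟨⟨l1a, l1b⟩, ⟨m1a, -⟩⟩ := fullPadding_letters (m := m) u v hs0 z hz i₁
  rw [hc₀] at l0a l0b m0a
  rw [hc₁] at l1a l1b m1a
  obtain ⟨ha₁, hb₁, hs₁, hPa₁, hPb₁, hne₁⟩ :=
    planted_pair (A := fun j => (Fin.append u (Fin.append z z) j).support ∪ (Fin.append v (Fin.append z z) j).support)
      (gadget_pos_ne (m := m) i₀) hs0 (show (2 : ℕ) ≠ 0 by decide) l0a l0b m0a
  obtain ⟨ha₂, hb₂, hs₂, hPa₂, hPb₂, hne₂⟩ :=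
    planted_pair (A := fun j => (Fin.append u (Fin.append z z) j).support ∪ (Fin.append v (Fin.append z z) j).support)
      (gadget_pos_ne (m := m) i₁) hs0 (show (10 : ℕ) ≠ 0 by decide) l1a l1b m1a
  -- distinct letters across the two pairs
  have d1 : (2 * 2) • s ≠ (10 : ℕ) • s := nsmul_ne_nsmul hs0 (by decide)
  have d2 : (2 * 2) • s ≠ (2 * 10) • s := nsmul_ne_nsmul hs0 (by decide)
  have d3 : (2 : ℕ) • s ≠ (10 : ℕ) • s := nsmul_ne_nsmul hs0 (by decide)
  have d4 : (2 : ℕ) • s ≠ (2 * 10) • s := nsmul_ne_nsmul hs0 (by decide)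
  have hdis : ∀ e,
      msetT (Pi.single (Fin.natAdd m (Fin.castAdd g i₀)) ((2 * 2) • s) +
          Pi.single (Fin.natAdd m (Fin.natAdd g i₀)) (0 : Expo) : Fin (m + (g + g)) → Expo) e =
        msetT (Pi.single (Fin.natAdd m (Fin.castAdd g i₀)) ((2 : ℕ) • s) +
          Pi.single (Fin.natAdd m (Fin.natAdd g i₀)) ((2 : ℕ) • s) : Fin (m + (g + g)) → Expo) e ∨
      msetT (Pi.single (Fin.natAdd m (Fin.castAdd g i₁)) ((2 * 10) • s) +
          Pi.single (Fin.natAdd m (Fin.natAdd g i₁)) (0 : Expo) : Fin (m + (g + g)) → Expo) e =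
        msetT (Pi.single (Fin.natAdd m (Fin.castAdd g i₁)) ((10 : ℕ) • s) +
          Pi.single (Fin.natAdd m (Fin.natAdd g i₁)) ((10 : ℕ) • s) : Fin (m + (g + g)) → Expo) e := by
    intro e
    rw [hPa₁, hPb₁, hPa₂, hPb₂]
    by_cases he₁ : e = (2 * 2) • s
    · subst he₁; right; simp [d1.symm, d2.symm]
    by_cases he₂ : e = (2 : ℕ) • s
    · subst he₂; right; simp [d3.symm, d4.symm]
    left; simp [Ne.symm he₁, Ne.symm he₂]
  exact ⟨fun hP => hne₁ (hP _ ha₁ _ hb₁ hs₁),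
    fun ρp ρm => no_rankOne_datum_of_two_coincidences ha₁ hb₁ hs₁ hne₁ ha₂ hb₂ hs₂ hne₂ hdis ρp ρm⟩

end Summit.ValiantsHypothesis.Theorems.TwoProducts.Negative.FullPadding
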